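import Mathlib
import HarnessLib
import Summits.Ventures.LatticeQCDFlow.Exactness.NCMCGeneralSpaceOccupancyChainCLT

/-!
# END TO END for the heat-bath (OBC / defect) shape: the NCMC lane between two bounded densities with heat-bath scans between switches has Gaussian `√n`-fluctuations of the occupancy and of `dF_occ` from EVERY initial state, for every `c ≠ ΔF`

HONEST FRAMING: exact (Metropolis-corrected) sampling algorithms for lattice gauge theory;
figures of merit are autocorrelation/cost numbers at stated couplings and volumes; no
continuum-physics claim.

Venture `LatticeQCDFlow` (cell pub-lqcd), topic `Exactness`; FANOUT row 13 (`eng-snf`, GEN-19).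
NEW WORK of the cell, not a published result; no definition is introduced; nothing is cited as a
fact.  ASSEMBLY of GEN-19's NCMC central limit theorems (`NCMCGeneralSpaceOccupancyChainCLT`:
`CrooksPair.ncmc_occupancy_clt_of_exists_sq`, `CrooksPair.ncmc_dFocc_clt_of_exists_sq`) with GEN-18's
unconditional two-step certificate for the heat-bath shape (`NCMCGeneralSpaceOccupancyChainDoeblinHeatBath`:
`heatBath_minorising`; `NCMCGeneralSpaceOccupancyChainHeatBath`: `heatBathSweep_package`;
`NCMCGeneralSpaceOccupancyChainDoeblinMirror`: `CrooksPair.ncmc_exists_sq_doeblin`, the Jarzynski sign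
`CrooksPair.bind_work_ne_ne_zero_of_ne`).  Engine: `latflow-snf`, `correction = ncmc-metropolis`;
prior weight `p₀ · ⊗μ` and target weight `p₁ · ⊗μ` on a finite product of probability spaces with
two-sided bounded densities (the OBC → PBC / defect protocols: one reference measure, two bounded
Boltzmann factors), level samplers the heat-bath scans `updates.sweep(…, 'hb')` over site lists
visiting every site, ANY Crooks pair (GEN-9: sweeps and coupling layers composed), ANY `c ≠ ΔF`.

## Content

* **`CrooksPair.ncmc_heatBath_occupancy_clt_of_ne`** — for every initial state `z` and every
  `Y ~ N(0, 2 τ_int(ρ_occ) σ(1 − σ))`: `√n (p̂_n − σ(c − ΔF)) ⇒ Y` under `P_{δ_z}`.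
* **`CrooksPair.ncmc_heatBath_dFocc_clt_of_ne`** — for every `Y ~ N(0, 2 τ_int(ρ_occ)/(σ(1 − σ)))`:
  `√n (dF_occ,n − ΔF) ⇒ Y` under `P_{δ_z}`.

NOT CLAIMED: the value of `τ_int(ρ_occ)` or of the Doeblin constant (`(m/M)^{|l|}`-type products ×
rejection masses — astronomically small; measured figures of merit); a typed consistent estimator of
`τ_int`; rates; `c = ΔF` with `W ≡ ΔF`.
-/

namespace Summit.Ventures.LatticeQCDFlow.Exactness.GeneralNCMC

open MeasureTheory ProbabilityTheory Set Filter Finset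
open scoped ENNReal Topology

section HeatBath

variable {ι : Type*} [Fintype ι] [DecidableEq ι] {X : ι → Type*} [∀ i, MeasurableSpace (X i)]
variable {μ : Π i, Measure (X i)} [∀ i, IsProbabilityMeasure (μ i)]

/-- **THE OCCUPANCY CLT FOR THE HEAT-BATH SHAPE, FROM EVERY INITIAL STATE, EVERY `c ≠ ΔF`.**  Prior
`p₀ · ⊗μ`, target `p₁ · ⊗μ` (`0 < m_k ≤ p_k ≤ M_k < ∞`), heat-bath scans over lists visiting every
site, ANY Crooks pair, `c ≠ ΔF`: for every initial state `z` and every `Y ~ N(0, 2 τ_int(ρ_occ) σ(1−σ))`,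
`√n (p̂_n − σ(c − ΔF))` converges in distribution to `Y` under `P_{δ_z}`. -/
theorem CrooksPair.ncmc_heatBath_occupancy_clt_of_ne {p₀ p₁ : (Π j, X j) → ℝ≥0∞}
    {m₀ M₀ m₁ M₁ : ℝ≥0∞}
    (hp₀ : Measurable p₀) (hm₀0 : m₀ ≠ 0) (hM₀ : M₀ ≠ ∞) (hmp₀ : ∀ ω, m₀ ≤ p₀ ω)
    (hpM₀ : ∀ ω, p₀ ω ≤ M₀) {l₀ : List ι} (hl₀ : ∀ i, i ∈ l₀)
    (hp₁ : Measurable p₁) (hm₁0 : m₁ ≠ 0) (hM₁ : M₁ ≠ ∞) (hmp₁ : ∀ ω, m₁ ≤ p₁ ω)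
    (hpM₁ : ∀ ω, p₁ ω ≤ M₁) {l₁ : List ι} (hl₁ : ∀ i, i ∈ l₁)
    {E : Type*} [MeasurableSpace E] {κF κR : Kernel (Π j, X j) E} [IsMarkovKernel κF]
    [IsMarkovKernel κR] {s e : E → (Π j, X j)} {W : E → ℝ}
    (h : CrooksPair ((Measure.pi μ).withDensity p₀) ((Measure.pi μ).withDensity p₁) κF κR s e W)
    {c ΔF : ℝ}
    (hΔF : Real.exp (-ΔF) = ((((Measure.pi μ).withDensity p₀) univ)⁻¹ *
      ((Measure.pi μ).withDensity p₁) univ).toReal) (hc : c ≠ ΔF) :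
    ∃ (_ : IsMarkovKernel (switchKernel κF κR c W s e))
      (_ : IsMarkovKernel (levelKernel (cycle (l₀.map (siteHeatBath μ p₀)))
        (cycle (l₁.map (siteHeatBath μ p₁))))),
      ∀ (z : Bool × (Π j, X j))
        [IsProbabilityMeasure (Kernel.trajMeasure (X := fun _ : ℕ => Bool × (Π j, X j))
            (Measure.dirac z)
            (fun n : ℕ => (switchKernel κF κR c W s e ∘ₖ
              levelKernel (cycle (l₀.map (siteHeatBath μ p₀))) (cycle (l₁.map (siteHeatBath μ p₁)))).comap
              (fun hh : (j : ↥(Finset.Iic n)) → Bool × (Π j, X j) => hh ⟨n, Finset.mem_Iic.2 le_rfl⟩)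
              (measurable_pi_apply _)))]
        {Ω' : Type*} [MeasurableSpace Ω'] {P' : Measure Ω'} [IsProbabilityMeasure P'] {Y : Ω' → ℝ},
        HasLaw Y (gaussianReal 0 (Real.toNNReal
          (2 * Scoring.tauInt (setACF (switchKernel κF κR c W s e ∘ₖ levelKernel (cycle (l₀.map (siteHeatBath μ p₀))) (cycle (l₁.map (siteHeatBath μ p₁))))
            ((jointWeight c ((Measure.pi μ).withDensity p₀) ((Measure.pi μ).withDensity p₁) univ)⁻¹ •
              jointWeight c ((Measure.pi μ).withDensity p₀) ((Measure.pi μ).withDensity p₁))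
            (targetLevel (Π j, X j)))
            * (Real.sigmoid (c - ΔF) * (1 - Real.sigmoid (c - ΔF)))))) P' →
        TendstoInDistribution (fun (n : ℕ) (x : ℕ → Bool × (Π j, X j)) =>
            Real.sqrt n * ((∑ i ∈ range n, (targetLevel (Π j, X j)).indicator
              (1 : Bool × (Π j, X j) → ℝ) (x i)) / n - Real.sigmoid (c - ΔF)))
          atTop Y (fun _ => Kernel.trajMeasure (X := fun _ : ℕ => Bool × (Π j, X j))
            (Measure.dirac z)
            (fun n : ℕ => (switchKernel κF κR c W s e ∘ₖ
              levelKernel (cycle (l₀.map (siteHeatBath μ p₀))) (cycle (l₁.map (siteHeatBath μ p₁)))).comap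
              (fun hh : (j : ↥(Finset.Iic n)) → Bool × (Π j, X j) => hh ⟨n, Finset.mem_Iic.2 le_rfl⟩)
              (measurable_pi_apply _))) P' := by
  obtain ⟨hMk₀, hfin₀, -, -, h0, -, hK₀, -⟩ := heatBathSweep_package (μ := μ) hp₀ hm₀0
    hM₀ hmp₀ hpM₀ hl₀
  obtain ⟨hMk₁, hfin₁, -, -, h1, -, hK₁, -⟩ := heatBathSweep_package (μ := μ) hp₁ hm₁0
    hM₁ hmp₁ hpM₁ hl₁
  obtain ⟨hmfin₀, hm₀, hmin₀, hac₀⟩ := heatBath_minorising (μ := μ) hp₀ hm₀0 hM₀ hmp₀ hpM₀ hl₀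
  obtain ⟨hmfin₁, hm₁, hmin₁, hac₁⟩ := heatBath_minorising (μ := μ) hp₁ hm₁0 hM₁ hmp₁ hpM₁ hl₁
  haveI := hMk₀
  haveI := hMk₁
  haveI := hfin₀
  haveI := hfin₁
  haveI := hmfin₀
  haveI := hmfin₁
  refine ⟨isMarkovKernel_switchKernel (κF := κF) (κR := κR) (c := c)
      h.measurable_W h.measurable_s h.measurable_e, isMarkovKernel_levelKernel _ _,
    fun z _ Ω' _ P' _ Y hY => ?_⟩
  exact h.ncmc_occupancy_clt_of_exists_sq h0 h1 hK₀ hK₁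
    (h.ncmc_exists_sq_doeblin hm₀ hm₁ hmin₀ hmin₁ hac₀ hac₁ c
      (h.bind_work_ne_ne_zero_of_ne h0 hΔF hc)) hΔF z hY

/-- **THE `dF_occ` CLT FOR THE HEAT-BATH SHAPE, FROM EVERY INITIAL STATE, EVERY `c ≠ ΔF`**: for every
initial state `z` and every `Y ~ N(0, 2 τ_int(ρ_occ)/(σ(1 − σ)))`, `√n (dF_occ,n − ΔF)` converges in
distribution to `Y` under `P_{δ_z}`. -/
theorem CrooksPair.ncmc_heatBath_dFocc_clt_of_ne {p₀ p₁ : (Π j, X j) → ℝ≥0∞}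
    {m₀ M₀ m₁ M₁ : ℝ≥0∞}
    (hp₀ : Measurable p₀) (hm₀0 : m₀ ≠ 0) (hM₀ : M₀ ≠ ∞) (hmp₀ : ∀ ω, m₀ ≤ p₀ ω)
    (hpM₀ : ∀ ω, p₀ ω ≤ M₀) {l₀ : List ι} (hl₀ : ∀ i, i ∈ l₀)
    (hp₁ : Measurable p₁) (hm₁0 : m₁ ≠ 0) (hM₁ : M₁ ≠ ∞) (hmp₁ : ∀ ω, m₁ ≤ p₁ ω)
    (hpM₁ : ∀ ω, p₁ ω ≤ M₁) {l₁ : List ι} (hl₁ : ∀ i, i ∈ l₁)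
    {E : Type*} [MeasurableSpace E] {κF κR : Kernel (Π j, X j) E} [IsMarkovKernel κF]
    [IsMarkovKernel κR] {s e : E → (Π j, X j)} {W : E → ℝ}
    (h : CrooksPair ((Measure.pi μ).withDensity p₀) ((Measure.pi μ).withDensity p₁) κF κR s e W)
    {c ΔF : ℝ}
    (hΔF : Real.exp (-ΔF) = ((((Measure.pi μ).withDensity p₀) univ)⁻¹ *
      ((Measure.pi μ).withDensity p₁) univ).toReal) (hc : c ≠ ΔF) :
    ∃ (_ : IsMarkovKernel (switchKernel κF κR c W s e))
      (_ : IsMarkovKernel (levelKernel (cycle (l₀.map (siteHeatBath μ p₀)))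
        (cycle (l₁.map (siteHeatBath μ p₁))))),
      ∀ (z : Bool × (Π j, X j))
        [IsProbabilityMeasure (Kernel.trajMeasure (X := fun _ : ℕ => Bool × (Π j, X j))
            (Measure.dirac z)
            (fun n : ℕ => (switchKernel κF κR c W s e ∘ₖ
              levelKernel (cycle (l₀.map (siteHeatBath μ p₀))) (cycle (l₁.map (siteHeatBath μ p₁)))).comap
              (fun hh : (j : ↥(Finset.Iic n)) → Bool × (Π j, X j) => hh ⟨n, Finset.mem_Iic.2 le_rfl⟩)
              (measurable_pi_apply _)))]
        {Ω' : Type*} [MeasurableSpace Ω'] {P' : Measure Ω'} [IsProbabilityMeasure P'] {Y : Ω' → ℝ},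
        HasLaw Y (gaussianReal 0 (Real.toNNReal
          (2 * Scoring.tauInt (setACF (switchKernel κF κR c W s e ∘ₖ levelKernel (cycle (l₀.map (siteHeatBath μ p₀))) (cycle (l₁.map (siteHeatBath μ p₁))))
            ((jointWeight c ((Measure.pi μ).withDensity p₀) ((Measure.pi μ).withDensity p₁) univ)⁻¹ •
              jointWeight c ((Measure.pi μ).withDensity p₀) ((Measure.pi μ).withDensity p₁))
            (targetLevel (Π j, X j)))
            / (Real.sigmoid (c - ΔF) * (1 - Real.sigmoid (c - ΔF)))))) P' →
        TendstoInDistribution (fun (n : ℕ) (x : ℕ → Bool × (Π j, X j)) =>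
            Real.sqrt n * ((c - Real.log
              ((∑ i ∈ range n, (targetLevel (Π j, X j)).indicator
                  (1 : Bool × (Π j, X j) → ℝ) (x i)) / n /
                (1 - (∑ i ∈ range n, (targetLevel (Π j, X j)).indicator
                  (1 : Bool × (Π j, X j) → ℝ) (x i)) / n))) - ΔF))
          atTop Y (fun _ => Kernel.trajMeasure (X := fun _ : ℕ => Bool × (Π j, X j))
            (Measure.dirac z)
            (fun n : ℕ => (switchKernel κF κR c W s e ∘ₖ
              levelKernel (cycle (l₀.map (siteHeatBath μ p₀))) (cycle (l₁.map (siteHeatBath μ p₁)))).comap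
              (fun hh : (j : ↥(Finset.Iic n)) → Bool × (Π j, X j) => hh ⟨n, Finset.mem_Iic.2 le_rfl⟩)
              (measurable_pi_apply _))) P' := by
  obtain ⟨hMk₀, hfin₀, -, -, h0, -, hK₀, -⟩ := heatBathSweep_package (μ := μ) hp₀ hm₀0
    hM₀ hmp₀ hpM₀ hl₀
  obtain ⟨hMk₁, hfin₁, -, -, h1, -, hK₁, -⟩ := heatBathSweep_package (μ := μ) hp₁ hm₁0
    hM₁ hmp₁ hpM₁ hl₁
  obtain ⟨hmfin₀, hm₀, hmin₀, hac₀⟩ := heatBath_minorising (μ := μ) hp₀ hm₀0 hM₀ hmp₀ hpM₀ hl₀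
  obtain ⟨hmfin₁, hm₁, hmin₁, hac₁⟩ := heatBath_minorising (μ := μ) hp₁ hm₁0 hM₁ hmp₁ hpM₁ hl₁
  haveI := hMk₀
  haveI := hMk₁
  haveI := hfin₀
  haveI := hfin₁
  haveI := hmfin₀
  haveI := hmfin₁
  refine ⟨isMarkovKernel_switchKernel (κF := κF) (κR := κR) (c := c)
      h.measurable_W h.measurable_s h.measurable_e, isMarkovKernel_levelKernel _ _,
    fun z _ Ω' _ P' _ Y hY => ?_⟩
  exact h.ncmc_dFocc_clt_of_exists_sq h0 h1 hK₀ hK₁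
    (h.ncmc_exists_sq_doeblin hm₀ hm₁ hmin₀ hmin₁ hac₀ hac₁ c
      (h.bind_work_ne_ne_zero_of_ne h0 hΔF hc)) hΔF z hY

end HeatBath

end Summit.Ventures.LatticeQCDFlow.Exactness.GeneralNCMC
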